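import Summits.CriticalPhenomena.PercolationContinuityZ3.Theorems.PercAnnulusCrossingIICRootBias
import Summits.CriticalPhenomena.PercolationContinuityZ3.Theorems.PercAnnulusCrossingSupercriticalSetToSetDefectLower
import Summits.CriticalPhenomena.PercolationContinuityZ3.Theorems.PercAnnulusCrossingIICRootedCylinders
import HarnessLib

/-!
# Every edge with an escape route is open-biased under Kesten's IIC (lane RSW3, p1 gen 8)

builds on p205010 (kernel theorem, internal audit signed; external expert review pending) — NOT used in this file.

RSW3 lane (LANE 3 `prim-rsw3`), seat `prim-rsw3-p1` (gen 8).  Helper file (`--supports stmt-CriticalPhenomena-4575`); no definitions, no sorries;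
every `d`, every `p`.  `…IICRootBias` proved `ν(s(0,y₀) open) > p` for the `2d` edges AT the origin.  Here: the same strict bias for an ARBITRARY
lattice edge `e₀ = s(a,b)`, given purely combinatorial data — a finite set `V ∋ 0, a`, connected through lattice edges `G` inside `V`,
`V ⊆ Λ(m−1)`, `b ∈ Λ(m)` — and an escape route: `P_p(b ↔ ∂ⁱⁿΛ(sm) in Λ(sm) ∖ V) > 0` (forcing `b ∉ V`; for `d ≥ 2` every edge of `ℤ^d` admits such data: an
`L`-shaped path to `a` whose continuation through `b` is a free ray).  Mechanism as in `…IICRootBias`: `ν(e₀ open)/p − ν(e₀ closed)/(1−p) =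
lim (P(A_n^{(e₀)}) − P(A_n^{(∅)}))/π(n)`, and the difference event contains `{G open} ∩ {other edges at V closed} ∩ {b ↔ ∂ⁱⁿΛ(n) off V}`, whose
probability is `≥ c·π(n)` by the obstacle quasi-multiplicativity of `…ObstacleQuasiMult` (obstacle `V`, source `{b}`).

* **`iicMeasure_edge_bias_pos`** — under (A2)□ at aspect `(s,L)` (`1 ≤ s`, `ϰ > 0`), `0 < p < 1`, `d ≥ 1`, with the data above:
  `0 < ν(e₀ ∈ ω)/p − ν(e₀ ∉ ω)/(1−p)`;
* **`iicMeasure_real_edge_gt`** — hence, for IIC probability measures, **`p < ν(s(a,b) ∈ ω)`**.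
* **`iicMeasure_real_radialEdge_gt`** — HYPOTHESIS-FREE beyond (A2)□ (`d ≥ 2`): for every RADIAL lattice edge `s(a,b)` (`a ∈ Λ(n)`, `b ∉ Λ(n)` for some `n`),
  **`p < ν(s(a,b) ∈ ω)`** — datum `V = Λ(n)` (internally connected, `…IICRootedCylinders.pathIn_box_zero`), escape by `…IICSupport`'s ray off `Λ(n+1) ∖ {b}`.
With p1 gen 7's mixing (`ν(e open) → p_c` as `e → ∞`): every (radial) edge is strictly open-biased, with bias vanishing at infinity.
References: H. Kesten, PTRF 73 (1986) Thm (3); D. Basu, A. Sapozhnikov, ECP 22 (2017) no. 26, Thm 1.1 and §2 (2.8).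
-/

noncomputable section

namespace Summit.CriticalPhenomena.PercolationContinuityZ3.Theorems.Crossing

open MeasureTheory Filter Topology Literature.Probability.Percolation Literature.Probability.LatticeModels
open Literature.Probability.Percolation.DCT16

variable {d : ℕ}

/-- **Strict open-bias of an edge with an escape route, quantitative form**: with the data of the file header,
`0 < ν(s(a,b) ∈ ω)/p − ν(s(a,b) ∉ ω)/(1−p)`. [cite: Kesten1986, Thm. (3)] [cite: BasuSapozhnikov2017ECP, Thm. 1.1 and §2 (2.8)] -/
theorem iicMeasure_edge_bias_pos (hd : 1 ≤ d) (p : unitInterval) (hp : 0 < (p : ℝ)) (hp1 : (p : ℝ) < 1) {s L : ℕ} (hs : 1 ≤ s)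
    {ϰ : ℝ} (hϰ : 0 < ϰ) (hA2 : SetToSetQuasiMultAspectAt d p s L ϰ) {ν : Measure (BondConfig (Site d))}
    (hν : ∀ (F : Finset (Sym2 (Site d))) (E : Set (BondConfig (Site d))), MeasurableSet E → DeterminedBy E ↑F →
      Tendsto (fun n : ℕ => (bondPercolation (zdGraph d) p).real (E ∩ siteToBoundary d n) / oneArmProb d p n)
        atTop (𝓝 (ν.real E)))
    {a b : Site d} (hab : (zdGraph d).Adj a b) {V : Finset (Site d)} (h0 : (0 : Site d) ∈ V) (ha : a ∈ V)
    {G : Finset (Sym2 (Site d))} (hGE : ∀ g ∈ G, g ∈ (zdGraph d).edgeSet) (hGV : ∀ g ∈ G, ∀ v ∈ g, v ∈ V)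
    (hVconn : ∀ v ∈ V, PathIn (openGraph (↑G : Set (Sym2 (Site d)))) (↑V : Set (Site d)) 0 v)
    {m : ℕ} (hm : 1 ≤ m) (hVm : V ⊆ box d (m - 1)) (hbm : b ∈ box d m)
    (hesc : 0 < (bondPercolation (zdGraph d) p).real {ω : BondConfig (Site d) | ∃ x ∈ ({b} : Finset (Site d)),
      ∃ t ∈ innerBoundary (zdGraph d) (box d (s * m)), ω ∈ openConnIn ((↑(box d (s * m)) : Set (Site d)) \ ↑V) x t}) :
    0 < ν.real {ω : BondConfig (Site d) | s(a, b) ∈ ω} / p - ν.real {ω : BondConfig (Site d) | s(a, b) ∉ ω} / (1 - p) := by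
  classical
  set μ := bondPercolation (zdGraph d) p with hμ
  set e₀ : Sym2 (Site d) := s(a, b) with he₀def
  have he₀ : e₀ ∈ (zdGraph d).edgeSet := (SimpleGraph.mem_edgeSet _).2 hab
  have hπ : ∀ n, 0 < oneArmProb d p n := oneArmProb_pos hd p hp
  have h1p : 0 < 1 - (p : ℝ) := by linarith
  -- the two sections of the arm event along `e₀`
  set f₁ : BondConfig (Site d) → BondConfig (Site d) := fun ω => ω \ (↑({e₀} : Finset (Sym2 (Site d))) : Set (Sym2 (Site d))) ∪
    (↑({e₀} : Finset (Sym2 (Site d))) : Set (Sym2 (Site d))) with hf₁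
  set f₀ : BondConfig (Site d) → BondConfig (Site d) := fun ω => ω \ (↑({e₀} : Finset (Sym2 (Site d))) : Set (Sym2 (Site d))) ∪
    (↑(∅ : Finset (Sym2 (Site d))) : Set (Sym2 (Site d))) with hf₀
  -- (a), (b): the IIC limits of `{e₀ open}` and `{e₀ closed}`
  have hdetO : DeterminedBy {ω : BondConfig (Site d) | e₀ ∈ ω} (↑({e₀} : Finset (Sym2 (Site d))) : Set (Sym2 (Site d))) := by
    rw [determinedBy_iff]; intro ω ω' h
    have := (Set.ext_iff.1 h) e₀
    simp only [Set.mem_inter_iff, Finset.coe_singleton, Set.mem_singleton_iff, and_true] at this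
    exact this
  have hdetC : DeterminedBy {ω : BondConfig (Site d) | e₀ ∉ ω} (↑({e₀} : Finset (Sym2 (Site d))) : Set (Sym2 (Site d))) := by
    rw [determinedBy_iff]; intro ω ω' h
    have := (Set.ext_iff.1 h) e₀
    simp only [Set.mem_inter_iff, Finset.coe_singleton, Set.mem_singleton_iff, and_true] at this
    simp only [Set.mem_setOf_eq, this]
  have hlimO := hν {e₀} _ (measurableSet_mem e₀) hdetO
  have hlimC := hν {e₀} _ (measurableSet_notMem e₀) hdetC
  have hO : ∀ n, μ.real ({ω : BondConfig (Site d) | e₀ ∈ ω} ∩ siteToBoundary d n) = (p : ℝ) * μ.real (f₁ ⁻¹' siteToBoundary d n) := by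
    intro n; rw [Set.inter_comm]; exact real_inter_mem_eq_mul_section p he₀ (measurableSet_siteToBoundary d n)
  have hC : ∀ n, μ.real ({ω : BondConfig (Site d) | e₀ ∉ ω} ∩ siteToBoundary d n) = (1 - (p : ℝ)) * μ.real (f₀ ⁻¹' siteToBoundary d n) := by
    intro n; rw [Set.inter_comm]; exact real_inter_notMem_eq_mul_section p he₀ (measurableSet_siteToBoundary d n)
  -- (c) the difference of the normalised limits
  have hdiff : Tendsto (fun n : ℕ => (μ.real (f₁ ⁻¹' siteToBoundary d n) - μ.real (f₀ ⁻¹' siteToBoundary d n)) / oneArmProb d p n)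
      atTop (𝓝 (ν.real {ω : BondConfig (Site d) | e₀ ∈ ω} / p - ν.real {ω : BondConfig (Site d) | e₀ ∉ ω} / (1 - p))) := by
    have h1 := hlimO.div_const (p : ℝ)
    have h2 := hlimC.div_const (1 - (p : ℝ))
    refine (h1.sub h2).congr' (Eventually.of_forall fun n => ?_)
    beta_reduce
    rw [hO n, hC n, mul_div_assoc, mul_div_cancel_left₀ _ hp.ne', mul_div_assoc, mul_div_cancel_left₀ _ h1p.ne', div_sub_div_same]
  -- (d) the pattern: `G` open, every other lattice edge at `V` (except `e₀`) closed
  set F' : Finset (Sym2 (Site d)) := ((box d m).sym2).filter fun g =>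
    g ∈ (zdGraph d).edgeSet ∧ (∃ v ∈ V, v ∈ g) ∧ g ∉ G ∧ g ≠ e₀ with hF'
  set Cyl : Set (BondConfig (Site d)) := {ω | (∀ g ∈ F', g ∉ ω) ∧ ∀ g ∈ G, g ∈ ω} with hCyl
  set γ : ℕ → ℝ := fun n => μ.real {ω : BondConfig (Site d) | ∃ x ∈ ({b} : Finset (Site d)),
    ∃ t ∈ innerBoundary (zdGraph d) (box d n), ω ∈ openConnIn ((↑(box d n) : Set (Site d)) \ ↑V) x t} with hγ
  have hVm' : (↑V : Set (Site d)) ⊆ ↑(box d m) := Finset.coe_subset.2 (hVm.trans (box_mono d (Nat.sub_le m 1)))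
  have hab' : a ≠ b := hab.ne
  -- (e) the inclusion `Cyl ∩ CONN_n ⊆ f₁⁻¹A_n \ f₀⁻¹A_n` for lattice configurations, `n ≥ m`
  have hincl : ∀ n, m ≤ n → ∀ ω : BondConfig (Site d), ω ⊆ (zdGraph d).edgeSet →
      ω ∈ Cyl ∩ {ω : BondConfig (Site d) | ∃ x ∈ ({b} : Finset (Site d)),
        ∃ t ∈ innerBoundary (zdGraph d) (box d n), ω ∈ openConnIn ((↑(box d n) : Set (Site d)) \ ↑V) x t} →
      ω ∈ f₁ ⁻¹' siteToBoundary d n \ f₀ ⁻¹' siteToBoundary d n := by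
    intro n hn ω hωE hω
    obtain ⟨⟨hcl, hop⟩, x, hx, t, ht, hxt⟩ := hω
    rw [Finset.mem_singleton] at hx
    rw [hx] at hxt
    have hVn : (↑V : Set (Site d)) ⊆ ↑(box d n) := hVm'.trans (Finset.coe_subset.2 (box_mono d hn))
    have hωf₁ : ω ⊆ f₁ ω := fun g hg => by
      by_cases hge : g = e₀
      · exact Or.inr (by simp [hge])
      · exact Or.inl ⟨hg, by simp [hge]⟩
    constructor
    · -- `f₁ ω ∈ A_n`: `0 → a` inside `V` through `G`, the edge `e₀`, then `b → ∂ⁱⁿΛ(n)` off `V`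
      show f₁ ω ∈ siteToBoundary d n
      have hP0a : PathIn (openGraph (f₁ ω)) (↑(box d n) : Set (Site d)) 0 a :=
        pathIn_map (f := id) (fun z hz => hVn hz) (fun z w _ _ hzw => by
          rw [openGraph_adj] at hzw ⊢
          exact ⟨hωf₁ (hop _ (Finset.mem_coe.1 hzw.1)), hzw.2⟩) (hVconn a ha)
      have hPbt : PathIn (openGraph (f₁ ω)) (↑(box d n) : Set (Site d)) b t :=
        pathIn_map (f := id) (fun z hz => hz.1) (fun z w _ _ hzw => by
          rw [openGraph_adj] at hzw ⊢
          exact ⟨hωf₁ hzw.1, hzw.2⟩) (pathIn_of_mem_openConnIn hxt)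
      have he₀f₁ : (openGraph (f₁ ω)).Adj a b := by
        rw [openGraph_adj]
        exact ⟨Or.inr (by simp [he₀def]), hab'⟩
      exact ⟨t, ht, mem_openConnIn_of_pathIn ((hP0a.trans (PathIn.of_adj hP0a.right_mem hPbt.left_mem he₀f₁)).trans hPbt)⟩
    · -- `f₀ ω ∉ A_n`: in `ω ∖ {e₀}` the cluster of `0` stays inside `V`
      show f₀ ω ∉ siteToBoundary d n
      have hf₀ω : f₀ ω ⊆ ω := by
        intro g hg
        simp only [hf₀, Finset.coe_empty, Set.union_empty, Set.mem_sdiff] at hg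
        exact hg.1
      rintro ⟨t', ht', h0t'⟩
      obtain ⟨_, hr⟩ := pathIn_of_mem_openConnIn h0t'
      -- every vertex reachable from `0` in `openGraph (f₀ ω)` lies in `V`
      have hstay : ∀ c : Site d, Relation.ReflTransGen (fun x y => (openGraph (f₀ ω)).Adj x y ∧ y ∈ (↑(box d n) : Set (Site d))) 0 c →
          c ∈ V := by
        intro c hc
        induction hc with
        | refl => exact h0
        | @tail x y _ hxy ih =>
          have hadj : (openGraph (f₀ ω)).Adj x y := hxy.1
          have hlat : (zdGraph d).Adj x y := adj_of_openGraph_adj (hf₀ω.trans hωE) hadj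
          rw [openGraph_adj] at hadj
          obtain ⟨hmem, hne⟩ := hadj
          simp only [hf₀, Finset.coe_empty, Set.union_empty, Set.mem_sdiff, Finset.coe_singleton, Set.mem_singleton_iff] at hmem
          obtain ⟨hgω, hge⟩ := hmem
          by_cases hgG : s(x, y) ∈ G
          · exact hGV _ hgG y (Sym2.mem_mk_right x y)
          · exfalso
            refine hcl _ ?_ hgω
            rw [hF', Finset.mem_filter, Finset.mk_mem_sym2_iff]
            have hxm : x ∈ box d m := box_mono d (Nat.sub_le m 1) (hVm ih)
            have hym : y ∈ box d m := by
              have h := DCT16.mem_box_succ_of_adj (hVm ih) hlat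
              rwa [Nat.sub_add_cancel hm] at h
            exact ⟨⟨hxm, hym⟩, hωE hgω, ⟨x, ih, Sym2.mem_mk_left x y⟩, hgG, hge⟩
      have ht'V : t' ∈ V := hstay t' hr
      exact notMem_box_of_mem_innerBoundary_box (by omega : m - 1 < n) ht' (hVm ht'V)
  -- (f) independence: `P(Cyl ∩ CONN_n) = P(Cyl) · γ(n)`
  have hCyldet : DeterminedBy Cyl (↑(F' ∪ G) : Set (Sym2 (Site d))) := determinedBy_cyl F' G
  have hGprob : ∀ n, μ.real (Cyl ∩ {ω : BondConfig (Site d) | ∃ x ∈ ({b} : Finset (Site d)),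
      ∃ t ∈ innerBoundary (zdGraph d) (box d n), ω ∈ openConnIn ((↑(box d n) : Set (Site d)) \ ↑V) x t}) = μ.real Cyl * γ n := by
    intro n
    have hdet2 : DeterminedBy {ω : BondConfig (Site d) | ∃ x ∈ ({b} : Finset (Site d)), ∃ t ∈ innerBoundary (zdGraph d) (box d n),
        ω ∈ openConnIn ((↑(box d n) : Set (Site d)) \ ↑V) x t} {e ∈ (((↑(box d n) : Set (Site d)) \ ↑V)).sym2 | ¬ e.IsDiag} := by
      have h : {ω : BondConfig (Site d) | ∃ x ∈ ({b} : Finset (Site d)), ∃ t ∈ innerBoundary (zdGraph d) (box d n),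
          ω ∈ openConnIn ((↑(box d n) : Set (Site d)) \ ↑V) x t} =
          ⋃ x ∈ ({b} : Finset (Site d)), ⋃ t ∈ innerBoundary (zdGraph d) (box d n), openConnIn ((↑(box d n) : Set (Site d)) \ ↑V) x t := by
        ext ω; simp only [Set.mem_setOf_eq, Set.mem_iUnion, exists_prop]
      rw [h]
      exact DeterminedBy.iUnion₂ fun x _ => DeterminedBy.iUnion₂ fun t _ => determinedBy_openConnIn_offDiag _ x t
    have hdisj : Disjoint (↑(F' ∪ G) : Set (Sym2 (Site d))) {e ∈ (((↑(box d n) : Set (Site d)) \ ↑V)).sym2 | ¬ e.IsDiag} := by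
      rw [Set.disjoint_left]
      intro g hg hg'
      rw [Finset.coe_union, Set.mem_union, Finset.mem_coe, Finset.mem_coe] at hg
      induction g using Sym2.ind with
      | h x y =>
        -- `s(x,y)` touches `V`
        obtain ⟨v, hvV, hvg⟩ : ∃ v ∈ V, v ∈ s(x, y) := by
          rcases hg with hg | hg
          · rw [hF', Finset.mem_filter] at hg
            exact hg.2.2.1
          · exact ⟨x, hGV _ hg x (Sym2.mem_mk_left x y), Sym2.mem_mk_left x y⟩
        have hxy := Set.mk_mem_sym2_iff.1 hg'.1
        rcases Sym2.mem_iff.1 hvg with rfl | rfl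
        · exact hxy.1.2 (Finset.mem_coe.2 hvV)
        · exact hxy.2.2 (Finset.mem_coe.2 hvV)
    exact bondPercolation_real_inter_of_disjoint (zdGraph d) p hdisj hCyldet hdet2 hCyldet.measurableSet_of_finset
      (measurableSet_link_sdiff n V {b})
  -- (g) `P(Cyl) > 0`
  have hCylpos : 0 < μ.real Cyl := by
    have hdet1 : DeterminedBy {ω : BondConfig (Site d) | ∀ g ∈ F', g ∉ ω} (↑F' : Set (Sym2 (Site d))) := determinedBy_forall_notMem F'
    have hdet2 : DeterminedBy {ω : BondConfig (Site d) | ∀ g ∈ G, g ∈ ω} (↑G : Set (Sym2 (Site d))) := by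
      rw [determinedBy_iff]; intro ω ω' h
      have key : ∀ g ∈ G, (g ∈ ω ↔ g ∈ ω') := fun g hg =>
        ⟨fun h1 => (((Set.ext_iff.1 h) g).1 ⟨h1, Finset.mem_coe.2 hg⟩).1, fun h1 => (((Set.ext_iff.1 h) g).2 ⟨h1, Finset.mem_coe.2 hg⟩).1⟩
      simp only [Set.mem_setOf_eq]
      exact forall₂_congr fun g hg => key g hg
    have hdisj : Disjoint (↑F' : Set (Sym2 (Site d))) ↑G := by
      rw [Finset.disjoint_coe, Finset.disjoint_left]
      intro g hg hgG
      rw [hF', Finset.mem_filter] at hg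
      exact hg.2.2.2.1 hgG
    have hset : Cyl = {ω : BondConfig (Site d) | ∀ g ∈ F', g ∉ ω} ∩ {ω : BondConfig (Site d) | ∀ g ∈ G, g ∈ ω} := by
      ext ω; simp only [hCyl, Set.mem_setOf_eq, Set.mem_inter_iff]
    rw [hset, bondPercolation_real_inter_of_disjoint (zdGraph d) p hdisj hdet1 hdet2 (measurableSet_forall_notMem F')
      hdet2.measurableSet_of_finset]
    have hF'E : ∀ g ∈ F', g ∈ (zdGraph d).edgeSet := fun g hg => by rw [hF', Finset.mem_filter] at hg; exact hg.2.1
    exact mul_pos (lt_of_lt_of_le (pow_pos h1p _) (pow_le_real_forall_notMem p F' hF'E))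
      (lt_of_lt_of_le (pow_pos hp _) (pow_le_real_forall_mem p G hGE))
  -- (h) obstacle quasi-multiplicativity: `ϰ γ(sm) π(n) ≤ γ(n) π(sm)`
  have hγn : ∀ n, L * m < n → s * m < n → ϰ * γ (s * m) * oneArmProb d p n ≤ γ n * oneArmProb d p (s * m) := fun n hLn hsn =>
    mul_real_link_sdiff_oneArmProb_le_of_setToSetQuasiMultAspectAt p hs hϰ.le hA2 hm hLn hsn hVm (Finset.singleton_subset_iff.2 hbm)
  -- (i) the lower bound, eventually
  set c := μ.real Cyl * (ϰ * γ (s * m) / oneArmProb d p (s * m)) with hcdef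
  have hcpos : 0 < c := mul_pos hCylpos (div_pos (mul_pos hϰ hesc) (hπ (s * m)))
  have hev : ∀ᶠ n : ℕ in atTop, c ≤ (μ.real (f₁ ⁻¹' siteToBoundary d n) - μ.real (f₀ ⁻¹' siteToBoundary d n)) / oneArmProb d p n := by
    filter_upwards [eventually_gt_atTop (max (max (L * m) (s * m)) m)] with n hn
    have hLn : L * m < n := lt_of_le_of_lt ((le_max_left _ _).trans (le_max_left _ _)) hn
    have hsn : s * m < n := lt_of_le_of_lt ((le_max_right _ _).trans (le_max_left _ _)) hn
    have hmn : m ≤ n := (le_max_right _ _).trans hn.le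
    have hmeas0 : MeasurableSet (f₀ ⁻¹' siteToBoundary d n) := measurableSet_section {e₀} ∅ (measurableSet_siteToBoundary d n)
    have hsub0 : f₀ ⁻¹' siteToBoundary d n ⊆ f₁ ⁻¹' siteToBoundary d n := fun ω hω =>
      isUpperSet_siteToBoundary d n (Set.union_subset_union_right _ (by simp)) hω
    have hGle : μ.real Cyl * γ n ≤ μ.real (f₁ ⁻¹' siteToBoundary d n) - μ.real (f₀ ⁻¹' siteToBoundary d n) := by
      rw [← hGprob n, ← measureReal_sdiff hsub0 hmeas0]
      exact real_mono_of_forall_subset_edgeSet (zdGraph d) p fun ω hωE hω => hincl n hmn ω hωE hω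
    rw [le_div_iff₀ (hπ n)]
    have hγn' := hγn n hLn hsn
    have hCyl0 : 0 ≤ μ.real Cyl := measureReal_nonneg
    calc c * oneArmProb d p n = μ.real Cyl * ((ϰ * γ (s * m) * oneArmProb d p n) / oneArmProb d p (s * m)) := by
          rw [hcdef]; ring
      _ ≤ μ.real Cyl * γ n := by
          refine mul_le_mul_of_nonneg_left ?_ hCyl0
          rw [div_le_iff₀ (hπ (s * m))]
          exact hγn'
      _ ≤ _ := hGle
  exact lt_of_lt_of_le hcpos (ge_of_tendsto hdiff hev)

/-- **Every edge with an escape route is open-biased under Kesten's IIC: `p < ν(s(a,b) ∈ ω)`** (IIC probability measures; data as in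
`iicMeasure_edge_bias_pos`). [cite: Kesten1986, Thm. (3)] [cite: BasuSapozhnikov2017ECP, Thm. 1.1] -/
theorem iicMeasure_real_edge_gt (hd : 1 ≤ d) (p : unitInterval) (hp : 0 < (p : ℝ)) (hp1 : (p : ℝ) < 1) {s L : ℕ} (hs : 1 ≤ s)
    {ϰ : ℝ} (hϰ : 0 < ϰ) (hA2 : SetToSetQuasiMultAspectAt d p s L ϰ) {ν : Measure (BondConfig (Site d))} [IsProbabilityMeasure ν]
    (hν : ∀ (F : Finset (Sym2 (Site d))) (E : Set (BondConfig (Site d))), MeasurableSet E → DeterminedBy E ↑F →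
      Tendsto (fun n : ℕ => (bondPercolation (zdGraph d) p).real (E ∩ siteToBoundary d n) / oneArmProb d p n)
        atTop (𝓝 (ν.real E)))
    {a b : Site d} (hab : (zdGraph d).Adj a b) {V : Finset (Site d)} (h0 : (0 : Site d) ∈ V) (ha : a ∈ V)
    {G : Finset (Sym2 (Site d))} (hGE : ∀ g ∈ G, g ∈ (zdGraph d).edgeSet) (hGV : ∀ g ∈ G, ∀ v ∈ g, v ∈ V)
    (hVconn : ∀ v ∈ V, PathIn (openGraph (↑G : Set (Sym2 (Site d)))) (↑V : Set (Site d)) 0 v)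
    {m : ℕ} (hm : 1 ≤ m) (hVm : V ⊆ box d (m - 1)) (hbm : b ∈ box d m)
    (hesc : 0 < (bondPercolation (zdGraph d) p).real {ω : BondConfig (Site d) | ∃ x ∈ ({b} : Finset (Site d)),
      ∃ t ∈ innerBoundary (zdGraph d) (box d (s * m)), ω ∈ openConnIn ((↑(box d (s * m)) : Set (Site d)) \ ↑V) x t}) :
    (p : ℝ) < ν.real {ω : BondConfig (Site d) | s(a, b) ∈ ω} := by
  have key := iicMeasure_edge_bias_pos hd p hp hp1 hs hϰ hA2 hν hab h0 ha hGE hGV hVconn hm hVm hbm hesc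
  have hcompl : ν.real {ω : BondConfig (Site d) | s(a, b) ∉ ω} = 1 - ν.real {ω : BondConfig (Site d) | s(a, b) ∈ ω} := by
    have hset : {ω : BondConfig (Site d) | s(a, b) ∉ ω} = {ω : BondConfig (Site d) | s(a, b) ∈ ω}ᶜ := by ext ω; simp
    rw [hset, measureReal_compl (measurableSet_mem _), probReal_univ]
  rw [hcompl] at key
  set x := ν.real {ω : BondConfig (Site d) | s(a, b) ∈ ω} with hx
  have h1p : 0 < 1 - (p : ℝ) := by linarith
  have : 0 < x * (1 - p) - (1 - x) * p := by
    have := mul_pos key (mul_pos hp h1p)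
    have heq : (x / p - (1 - x) / (1 - p)) * (p * (1 - p)) = x * (1 - p) - (1 - x) * p := by field_simp
    linarith [heq]
  nlinarith

/-- **Every RADIAL edge is open-biased under Kesten's IIC: `p < ν(s(a,b) ∈ ω)`** whenever `a ∈ Λ(n)`, `b ∉ Λ(n)` for some `n` (`a ∼ b`), for
every IIC probability measure `ν` at `p` (`0 < p < 1`, `d ≥ 2`) under (A2)□ at aspect `(s,L)` (`1 ≤ s`, `ϰ > 0`) — no further hypothesis: the
datum of `iicMeasure_real_edge_gt` is `V = Λ(n)` with its internal lattice edges, `m = n + 1`, and the escape route is a ray from `b ∈ ∂ⁱⁿΛ(n+1)`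
off `Λ(n+1) ∖ {b}` (`pow_le_real_link_sdiff_single`). [cite: Kesten1986, Thm. (3)] [cite: BasuSapozhnikov2017ECP, Thm. 1.1] -/
theorem iicMeasure_real_radialEdge_gt (hd : 2 ≤ d) (p : unitInterval) (hp : 0 < (p : ℝ)) (hp1 : (p : ℝ) < 1) {s L : ℕ} (hs : 1 ≤ s)
    {ϰ : ℝ} (hϰ : 0 < ϰ) (hA2 : SetToSetQuasiMultAspectAt d p s L ϰ) {ν : Measure (BondConfig (Site d))} [IsProbabilityMeasure ν]
    (hν : ∀ (F : Finset (Sym2 (Site d))) (E : Set (BondConfig (Site d))), MeasurableSet E → DeterminedBy E ↑F →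
      Tendsto (fun n : ℕ => (bondPercolation (zdGraph d) p).real (E ∩ siteToBoundary d n) / oneArmProb d p n)
        atTop (𝓝 (ν.real E)))
    {a b : Site d} (hab : (zdGraph d).Adj a b) {n : ℕ} (ha : a ∈ box d n) (hb : b ∉ box d n) :
    (p : ℝ) < ν.real {ω : BondConfig (Site d) | s(a, b) ∈ ω} := by
  classical
  set G : Finset (Sym2 (Site d)) := ((box d n).sym2).filter (fun e => e ∈ (zdGraph d).edgeSet) with hGdef
  have hGE : ∀ g ∈ G, g ∈ (zdGraph d).edgeSet := fun g hg => (Finset.mem_filter.1 hg).2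
  have hGV : ∀ g ∈ G, ∀ v ∈ g, v ∈ box d n := fun g hg => Finset.mem_sym2_iff.1 (Finset.mem_filter.1 hg).1
  have hVconn : ∀ v ∈ box d n, PathIn (openGraph (↑G : Set (Sym2 (Site d)))) (↑(box d n) : Set (Site d)) 0 v := by
    intro v hv
    refine pathIn_map (f := id) (fun z hz => hz) (fun z w hz hw hzw => ?_) (pathIn_box_zero hd n hv)
    rw [openGraph_adj]
    refine ⟨Finset.mem_coe.2 (Finset.mem_filter.2 ⟨Finset.mem_sym2_iff.2 fun x hx => ?_, (SimpleGraph.mem_edgeSet _).2 hzw⟩), hzw.ne⟩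
    rcases Sym2.mem_iff.1 hx with rfl | rfl
    · exact Finset.mem_coe.1 hz
    · exact Finset.mem_coe.1 hw
  have hbm : b ∈ box d (n + 1) := DCT16.mem_box_succ_of_adj ha hab
  have hbib : b ∈ innerBoundary (zdGraph d) (box d (n + 1)) :=
    mem_innerBoundary_box_of_notMem_pred (by omega) hbm (by simpa using hb)
  have hVm : box d n ⊆ box d (n + 1 - 1) := by simp
  -- escape route: a ray from `b` off `Λ(n+1) ∖ {b} ⊇ Λ(n)`
  have hesc : 0 < (bondPercolation (zdGraph d) p).real {ω : BondConfig (Site d) | ∃ x ∈ ({b} : Finset (Site d)),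
      ∃ t ∈ innerBoundary (zdGraph d) (box d (s * (n + 1))), ω ∈ openConnIn ((↑(box d (s * (n + 1))) : Set (Site d)) \ ↑(box d n)) x t} := by
    have haN : n + 1 ≤ s * (n + 1) := Nat.le_mul_of_pos_left (n + 1) (by omega)
    have hlow := pow_le_real_link_sdiff_single (d := d) p haN hbib
    have hsub : {ω : BondConfig (Site d) | ∃ x ∈ ({b} : Finset (Site d)), ∃ t ∈ innerBoundary (zdGraph d) (box d (s * (n + 1))),
        ω ∈ openConnIn ((↑(box d (s * (n + 1))) : Set (Site d)) \ ↑((box d (n + 1)).erase b)) x t} ⊆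
        {ω : BondConfig (Site d) | ∃ x ∈ ({b} : Finset (Site d)), ∃ t ∈ innerBoundary (zdGraph d) (box d (s * (n + 1))),
        ω ∈ openConnIn ((↑(box d (s * (n + 1))) : Set (Site d)) \ ↑(box d n)) x t} := by
      rintro ω ⟨x, hx, t, ht, hxt⟩
      refine ⟨x, hx, t, ht, openConnIn_mono (Set.sdiff_subset_sdiff_right ?_) x t hxt⟩
      rw [Finset.coe_subset]
      intro z hz
      exact Finset.mem_erase.2 ⟨fun h => hb (h ▸ hz), box_mono d (Nat.le_succ n) hz⟩
    have hmono := measureReal_mono hsub (measure_ne_top (bondPercolation (zdGraph d) p) _)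
    exact lt_of_lt_of_le (pow_pos hp _) (hlow.trans hmono)
  exact iicMeasure_real_edge_gt (by omega) p hp hp1 hs hϰ hA2 hν hab (zero_mem_box d n) ha hGE hGV hVconn (by omega) hVm hbm hesc

end Summit.CriticalPhenomena.PercolationContinuityZ3.Theorems.Crossing
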